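import Summits.ResolutionOfSingularities.ResolutionOfSingularities.Theorems.PAlterationAssembly2
import Summits.ResolutionOfSingularities.ResolutionOfSingularities.Theorems.PAlterationPialtReductions
import Summits.ResolutionOfSingularities.ResolutionOfSingularities.Theorems.PAlterationPialtKnownCases
import Literature.AlgebraicGeometry.Resolution.ProperModelsFunctionField
import HarnessLib

/-!
# `Pialt` (crux stmt-ResolutionOfSingularities-0555), line SketchIdeator2 (PiTMP programme):
# the conclusion of `Pialt` from a regular proper model of a purely inseparable extension

Final plumbing of the purely inseparable two-model patching (PiTMP) programme: a REGULAR proper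
model `N` of a finite purely inseparable extension `L/K`, dominating a NORMAL proper model `M` of
`K/k` along `K ⊆ L` (`φ : N.X ⟶ M.X` over `k`, compatible with the `K`- and `L`-points), yields the
conclusion of the crux `Pialt` at `M.X`. Proof: factor `φ` through Mathlib's relative
normalisation `M.X ← φ.normalization ← N.X`.

* `φ` is proper and dominant, and the field map `φ^♯ : K(M) → K(N)` is `K → L` under the
  identifications `K(M) ≅ K`, `K(N) ≅ L` of the two models (`funFieldIso_functionFieldMap`), so
  `K(N)/K(M)` is finite purely inseparable and `φ` is quasi-finite at the generic point of `N.X`;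
* Zariski's Main Theorem (Mathlib `Scheme.Hom.exists_isIso_morphismRestrict_toNormalization`):
  `N.X → φ.normalization` is an isomorphism over a non-empty, hence dense, open, so the regular
  `N.X` resolves `φ.normalization`;
* `φ.normalization → M.X` is finite (E. Noether, `isFinite_fromNormalization_of_finiteDimensional`),
  universally injective as `M.X` is normal (`universallyInjective_fromNormalization`) and
  surjective (as the proper dominant `φ` is), so the conclusion of `Pialt` descends from
  `φ.normalization` (`pialtConclusion_of_hasResolution`) to `M.X`
  (`pialtConclusion_of_finite_universallyInjective_surjective`).
-/

set_option linter.dupNamespace false -- mandated namespace of this single-conjunct summit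

noncomputable section

open CategoryTheory AlgebraicGeometry IsLocalRing
open Literature.AlgebraicGeometry.Resolution

namespace Summit.ResolutionOfSingularities.ResolutionOfSingularities.Theorems.Pialt.RadiciallyRegular

open Literature.AlgebraicGeometry.Motives Literature.AlgebraicGeometry.Motives.RatFn

section TwoFields

variable {k K L : Type} [Field k] [Field K] [Field L] [Algebra k K] [Algebra k L] [Algebra K L]
  (M : ProperModel k K) (N : ProperModel k L) (φ : N.X ⟶ M.X)

/-- A morphism `φ : N.X → M.X` between proper models of `L ⊇ K` compatible with the distinguished
points maps the generic point to the generic point. [folklore] -/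
theorem apply_genericPoint_of_gen_comp
    (hgen : N.gen ≫ φ = Spec.map (CommRingCat.ofHom (algebraMap K L)) ≫ M.gen) :
    φ (genericPoint N.X) = genericPoint M.X := by
  have h1 : (N.gen ≫ φ) (closedPoint L) = φ (genericPoint N.X) := by
    rw [Scheme.Hom.comp_apply, N.genericPt_eq]
  rw [← h1, hgen, Scheme.Hom.comp_apply,
    ProjModel.eq_closedPoint_of_field (Spec.map (CommRingCat.ofHom (algebraMap K L)) (closedPoint L))]
  exact M.genericPt_eq

/-- Such a `φ` is dominant. [folklore] -/
theorem isDominant_of_gen_comp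
    (hgen : N.gen ≫ φ = Spec.map (CommRingCat.ofHom (algebraMap K L)) ≫ M.gen) :
    IsDominant φ := by
  refine ⟨dense_iff_closure_eq.mpr (Set.eq_univ_of_univ_subset ?_)⟩
  calc (Set.univ : Set M.X) = closure {genericPoint M.X} := (genericPoint_spec M.X).def.symm
    _ ⊆ closure (Set.range φ) := closure_mono
        (Set.singleton_subset_iff.mpr ⟨genericPoint N.X, apply_genericPoint_of_gen_comp M N φ hgen⟩)

omit [Algebra K L] in
/-- Such a `φ` over `k` is proper (`N.X` is proper and `M.X` is separated over `k`). [folklore] -/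
theorem isProper_of_comp_π (hπ : φ ≫ M.π = N.π) : IsProper φ := by
  haveI : IsProper (φ ≫ M.π) := by rw [hπ]; infer_instance
  exact IsProper.of_comp φ M.π

/-- A proper dominant morphism is surjective. [folklore] -/
theorem surjective_of_isProper_of_isDominant {X Y : Scheme.{0}} (f : X ⟶ Y) [IsProper f]
    [IsDominant f] : Function.Surjective f := by
  have hc : IsClosed (Set.range f) := f.isClosedMap.isClosed_range
  have hd : Dense (Set.range f) := f.denseRange
  rw [← Set.range_eq_univ, ← hc.closure_eq, hd.closure_eq]

/-- **The field map of `φ` is `K → L`**: under `K(M) ≅ K` and `K(N) ≅ L`, the map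
`φ^♯ : K(M) → K(N)` of function fields is `algebraMap K L` — both sides induce the `L`-point
`gen_N ≫ φ = Spec (K → L) ≫ gen_M`. [folklore] -/
theorem funFieldIso_functionFieldMap [IsDominant φ]
    (hgen : N.gen ≫ φ = Spec.map (CommRingCat.ofHom (algebraMap K L)) ≫ M.gen) :
    CommRingCat.ofHom (functionFieldMap φ) ≫ N.funFieldIso.hom =
      M.funFieldIso.hom ≫ CommRingCat.ofHom (algebraMap K L) := by
  haveI : IsLocalHom (CommRingCat.ofHom (functionFieldMap φ) ≫ N.funFieldIso.hom).hom :=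
    isLocalHom_of_field _
  haveI : IsLocalHom (M.funFieldIso.hom ≫ CommRingCat.ofHom (algebraMap K L)).hom :=
    isLocalHom_of_field _
  apply hom_ext_of_specMap_comp_fromSpecStalk
  rw [Spec.map_comp, Category.assoc, specMap_functionFieldMap_fromSpecStalk,
    ProperModel.specMap_funFieldIso_hom_fromSpecStalk_assoc, hgen, Spec.map_comp, Category.assoc,
    ProperModel.specMap_funFieldIso_hom_fromSpecStalk]

/-- Pointwise form of `funFieldIso_functionFieldMap`. [folklore] -/
theorem funFieldIso_hom_functionFieldMap_apply [IsDominant φ]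
    (hgen : N.gen ≫ φ = Spec.map (CommRingCat.ofHom (algebraMap K L)) ≫ M.gen)
    (a : M.X.functionField) :
    N.funFieldIso.hom.hom (functionFieldMap φ a) = algebraMap K L (M.funFieldIso.hom.hom a) := by
  have h := congr(($(funFieldIso_functionFieldMap M N φ hgen)).hom a)
  simpa using h

/-- `φ^♯ = (L ≅ K(N)) ∘ (K → L) ∘ (K(M) ≅ K)`. [folklore] -/
theorem functionFieldMap_eq [IsDominant φ]
    (hgen : N.gen ≫ φ = Spec.map (CommRingCat.ofHom (algebraMap K L)) ≫ M.gen) :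
    functionFieldMap φ =
      (N.funFieldIso.inv.hom.comp (algebraMap K L)).comp M.funFieldIso.hom.hom := by
  ext a
  simp only [RingHom.comp_apply]
  rw [← funFieldIso_hom_functionFieldMap_apply M N φ hgen, ← CommRingCat.comp_apply,
    Iso.hom_inv_id, CommRingCat.id_apply]

/-- `φ^♯ : K(M) → K(N)` is finite when `L/K` is. [folklore] -/
theorem finite_functionFieldMap [IsDominant φ] [FiniteDimensional K L]
    (hgen : N.gen ≫ φ = Spec.map (CommRingCat.ofHom (algebraMap K L)) ≫ M.gen) :
    (functionFieldMap φ).Finite := by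
  rw [functionFieldMap_eq M N φ hgen]
  refine RingHom.Finite.comp (RingHom.Finite.comp ?_ ?_) ?_
  · exact RingHom.Finite.of_surjective _ N.funFieldIso.symm.commRingCatIsoToRingEquiv.surjective
  · exact RingHom.finite_algebraMap.mpr inferInstance
  · exact RingHom.Finite.of_surjective _ M.funFieldIso.commRingCatIsoToRingEquiv.surjective

/-- `K(N)/K(M)` is finite when `L/K` is. [folklore] -/
theorem finiteDimensional_functionFieldOver [IsDominant φ] [FiniteDimensional K L]
    (hgen : N.gen ≫ φ = Spec.map (CommRingCat.ofHom (algebraMap K L)) ≫ M.gen) :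
    FiniteDimensional M.X.functionField (FunctionFieldOver φ) :=
  finite_functionFieldMap M N φ hgen

/-- `φ` is quasi-finite at the generic point of `N.X` when `L/K` is finite: the stalk map there
is a factor of the finite `φ^♯`. [folklore] -/
theorem quasiFiniteAt_genericPoint [IsDominant φ] [FiniteDimensional K L]
    (hgen : N.gen ≫ φ = Spec.map (CommRingCat.ofHom (algebraMap K L)) ≫ M.gen) :
    φ.QuasiFiniteAt (genericPoint N.X) := by
  have h : ((φ.stalkMap (genericPoint N.X)).hom.comp
      (M.X.presheaf.stalkSpecializes (specializes_genericPoint φ)).hom).QuasiFinite := by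
    rw [← CommRingCat.hom_comp]
    exact .of_finite (finite_functionFieldMap M N φ hgen)
  exact h.of_comp

/-- `K(M)` has characteristic `p` when `k` has. [folklore] -/
theorem charP_functionField_properModel (p : ℕ) [CharP k p] : CharP M.X.functionField p :=
  ((algebraMap k M.X.functionField).charP_iff_charP p).mp ‹_›

/-- `K(N)/K(M)` is purely inseparable when `L/K` is. [folklore] -/
theorem isPurelyInseparable_functionFieldOver [IsDominant φ] (p : ℕ) [Fact p.Prime] [CharP k p]
    [IsPurelyInseparable K L]
    (hgen : N.gen ≫ φ = Spec.map (CommRingCat.ofHom (algebraMap K L)) ≫ M.gen) :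
    IsPurelyInseparable M.X.functionField (FunctionFieldOver φ) := by
  haveI : CharP K p := ((algebraMap k K).charP_iff_charP p).mp ‹_›
  haveI : ExpChar K p := ExpChar.prime Fact.out
  haveI : CharP M.X.functionField p := charP_functionField_properModel M p
  haveI : ExpChar M.X.functionField p := ExpChar.prime Fact.out
  rw [isPurelyInseparable_iff_pow_mem M.X.functionField p]
  intro x
  obtain ⟨n, y, hy⟩ :=
    IsPurelyInseparable.pow_mem K p (N.funFieldIso.hom.hom ((FunctionFieldOver.of φ).symm x))
  refine ⟨n, M.funFieldIso.inv.hom y, ?_⟩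
  rw [FunctionFieldOver.algebraMap_apply, functionFieldMap_eq M N φ hgen]
  simp only [RingHom.comp_apply]
  rw [← CommRingCat.comp_apply M.funFieldIso.inv M.funFieldIso.hom, Iso.inv_hom_id,
    CommRingCat.id_apply, hy, map_pow, ← CommRingCat.comp_apply, Iso.hom_inv_id,
    CommRingCat.id_apply, map_pow, RingEquiv.apply_symm_apply]

/-- **`N.X → φ.normalization` is birational** when `L/K` is finite (Zariski's Main Theorem: it is
an isomorphism over an open whose preimage is the quasi-finite locus of `φ`, which contains the
generic point of `N.X`; non-empty opens of integral schemes are dense). [folklore] -/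
theorem isBirational_toNormalization_of_gen_comp [IsDominant φ] [FiniteDimensional K L]
    [IsProper φ]
    (hgen : N.gen ≫ φ = Spec.map (CommRingCat.ofHom (algebraMap K L)) ≫ M.gen) :
    IsBirational φ.toNormalization := by
  obtain ⟨W, hW, hW'⟩ := φ.exists_isIso_morphismRestrict_toNormalization
  have hξ : genericPoint N.X ∈ φ.toNormalization ⁻¹ᵁ W := by
    change genericPoint N.X ∈ (φ.toNormalization ⁻¹ᵁ W).1
    rw [hW']
    exact quasiFiniteAt_genericPoint M N φ hgen
  have hpre : Dense ((φ.toNormalization ⁻¹ᵁ W : N.X.Opens) : Set N.X) :=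
    (φ.toNormalization ⁻¹ᵁ W).2.dense ⟨_, hξ⟩
  have hWd : Dense (W : Set φ.normalization) :=
    W.2.dense ⟨φ.toNormalization (genericPoint N.X), hξ⟩
  exact ⟨W, hWd, hpre, hW⟩

end TwoFields

/-- **The conclusion of `Pialt` at a normal proper model dominated, along a finite purely
inseparable extension `L/K`, by a regular proper model of `L`.** A REGULAR proper model `N` of
`L`, dominating the NORMAL proper model `M` of `K` compatibly with `K ⊆ L`, yields a proper
surjective `g : X' → M.X` with `X'` integral regular, finite and universally injective over a dense
open: `X'` is any resolution-induced alteration of the relative normalisation `φ.normalization` of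
`M.X` in `N.X`, which is finite, radicial and surjective over `M.X` and resolved by `N.X`
(Zariski's Main Theorem). [folklore] -/
theorem pialtConclusion_of_regular_piModel (p : ℕ) [Fact p.Prime]
    (k : Type) [Field k] [CharP k p] (K L : Type) [Field K] [Field L] [Algebra k K] [Algebra k L]
    [Algebra K L] [IsScalarTower k K L] [FiniteDimensional K L] [IsPurelyInseparable K L]
    (M : ProperModel k K) (N : ProperModel k L)
    (hnorm : ∀ x : M.X, IsIntegrallyClosed (M.X.presheaf.stalk x))
    (φ : N.X ⟶ M.X) (hπ : φ ≫ M.π = N.π)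
    (hgen : N.gen ≫ φ = Spec.map (CommRingCat.ofHom (algebraMap K L)) ≫ M.gen)
    (hreg : Scheme.IsRegular N.X) :
    ∃ (X' : Scheme.{0}) (g : X' ⟶ M.X), IsProper g ∧ IsIntegral X' ∧ Scheme.IsRegular X' ∧
      Function.Surjective g.base ∧ ∃ U : M.X.Opens, Dense (U : Set M.X) ∧ IsFinite (g ∣_ U) ∧
        UniversallyInjective (g ∣_ U) := by
  haveI : IsDominant φ := isDominant_of_gen_comp M N φ hgen
  haveI : IsProper φ := isProper_of_comp_π M N φ hπ
  haveI : FiniteDimensional M.X.functionField (FunctionFieldOver φ) :=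
    finiteDimensional_functionFieldOver M N φ hgen
  haveI : IsPurelyInseparable M.X.functionField (FunctionFieldOver φ) :=
    isPurelyInseparable_functionFieldOver M N φ p hgen
  haveI : CharP M.X.functionField p := charP_functionField_properModel M p
  -- the relative normalisation `M.X ← φ.normalization ← N.X`
  have hres : Scheme.HasResolution φ.normalization :=
    haveI := isProper_toNormalization φ
    ⟨N.X, φ.toNormalization,
      ⟨inferInstance, isBirational_toNormalization_of_gen_comp M N φ hgen, hreg⟩⟩
  haveI : IsFinite φ.fromNormalization := isFinite_fromNormalization_of_finiteDimensional φ M.π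
  haveI : UniversallyInjective φ.fromNormalization :=
    universallyInjective_fromNormalization φ hnorm p
  haveI : Surjective φ.fromNormalization := by
    refine ⟨fun x => ?_⟩
    obtain ⟨y, hy⟩ := surjective_of_isProper_of_isDominant φ x
    refine ⟨φ.toNormalization y, ?_⟩
    rw [← Scheme.Hom.comp_apply, φ.toNormalization_fromNormalization]
    exact hy
  exact pialtConclusion_of_finite_universallyInjective_surjective φ.fromNormalization
    (pialtConclusion_of_hasResolution φ.normalization hres)

end Summit.ResolutionOfSingularities.ResolutionOfSingularities.Theorems.Pialt.RadiciallyRegular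

end
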